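import Literature.Analysis.UnboundedOperators.HeatKernel
import Mathlib.Analysis.Complex.Exponential
import HarnessLib

/-!
# Spatial decay of the caloric extension of compactly supported data

Analysis/UnboundedOperators support file. For a continuous compactly supported `g : E → F`
(`E` a finite-dimensional real inner product space, `F` a real normed space) and a time `t > 0`,
the caloric extension `heatExtension g t = G_t ⋆ g` (`HeatKernel.lean`) decays like the Gauss
kernel away from the support: if `g` vanishes off the closed ball of radius `ρ`, then for
`‖x‖ ≥ 2ρ` every point `y` with `g (x - y) ≠ 0` has `‖y‖ ≥ ‖x‖/2`, whence

  `‖(G_t ⋆ g)(x)‖ ≤ (4πt)^{-n/2} exp(-‖x‖²/(16 t)) ‖g‖_{L¹}`   (`norm_heatExtension_le_exp_mul`),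

and consequently, using `u^m e^{-u} ≤ m!` (`Real.pow_div_factorial_le_exp`), all the weighted
sup norms `sup_x ‖x‖^k ‖(G_t ⋆ g)(x)‖` are finite (`exists_pow_mul_norm_heatExtension_le`).
This is the elementary decay input for truncating the caloric test fields `e^{νσΔ}φ`,
`φ ∈ C_c^∞`, of the duality (very weak) formulation of the Navier–Stokes equations
(Fabes–Jones–Rivière 1972, Thm. 2.1) at spatial infinity.

Also recorded: the sup bound `‖(G_t ⋆ g)(x)‖ ≤ sup ‖g‖` (`norm_heatExtension_le_of_bound`, from
`∫ G_t = 1`, `G_t ≥ 0`).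

## Mathlib / tree search

Tree: `heatKernel`, `heatExtension`, `heatExtension_apply`, `heatKernel_pos`, `heatKernel_le`,
`integral_heatKernel_eq_one_holds`, `integrable_heatKernel_holds` (`HeatKernel.lean`); the
neighbouring `heatKernel_le_of_le_norm` / `norm_heatFlow_le` (`HeatFlowCalculus.lean`,
`FluidPDE/MildSolutionProofs.lean`) give Gaussian off-diagonal bounds for `σ ≤ 1` and the sup
bound for `heatFlow`, not the weighted decay (`lean search 'pow_mul_norm_heatExtension|decay'`).
Mathlib: `Real.pow_div_factorial_le_exp`, `Real.exp_le_exp`, `norm_integral_le_of_norm_le`,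
`HasCompactSupport.exists_bound_of_continuous`, `IsCompact.isBounded`,
`Bornology.IsBounded.subset_closedBall`.

## References

* L. C. Evans, *Partial Differential Equations*, 2nd ed. (2010), §2.3.1 (the fundamental
  solution and its Gaussian decay).
* E. B. Fabes, B. F. Jones, N. M. Rivière, Arch. Rational Mech. Anal. 45 (1972), Thm. 2.1.
-/

noncomputable section

open MeasureTheory Set Filter Topology Metric Real
open scoped ENNReal NNReal Convolution

namespace Literature.Analysis.UnboundedOperators

variable {E : Type*} [NormedAddCommGroup E] [InnerProductSpace ℝ E] [FiniteDimensional ℝ E]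
  [MeasurableSpace E] [BorelSpace E]
variable {F : Type*} [NormedAddCommGroup F] [NormedSpace ℝ F]

/-! ### Off-diagonal bound of the kernel -/

omit [FiniteDimensional ℝ E] [MeasurableSpace E] [BorelSpace E] in
/-- **Off-diagonal Gaussian bound**: if `‖x‖ ≤ 2‖y‖` then
`heatKernel t y ≤ (4πt)^{-n/2} exp(-‖x‖²/(16 t))` (`0 < t`): the kernel is radially decreasing
and `‖y‖² ≥ ‖x‖²/4`. [folklore] -/
theorem heatKernel_le_exp_of_norm_le_two_mul {t : ℝ} (ht : 0 < t) {x y : E} (h : ‖x‖ ≤ 2 * ‖y‖) :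
    heatKernel t y ≤
      (4 * π * t) ^ (-(Module.finrank ℝ E : ℝ) / 2) * Real.exp (-‖x‖ ^ 2 / (16 * t)) := by
  unfold heatKernel
  refine mul_le_mul_of_nonneg_left (Real.exp_le_exp.2 ?_) (by positivity)
  rw [neg_div, neg_div, neg_le_neg_iff, div_le_div_iff₀ (by positivity) (by positivity)]
  have hx : ‖x‖ ^ 2 ≤ 4 * ‖y‖ ^ 2 := by nlinarith [norm_nonneg x, norm_nonneg y]
  nlinarith [ht]

/-! ### Decay of the caloric extension of compactly supported data -/

/-- **Gaussian decay of `G_t ⋆ g` off the support.** If `g` is continuous and vanishes off the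
closed ball `B̄(0, ρ)`, then for `0 < t` and `2ρ ≤ ‖x‖`,
`‖heatExtension g t x‖ ≤ (4πt)^{-n/2} exp(-‖x‖²/(16 t)) ∫ ‖g‖`: in
`∫ G_t(y) g(x - y) dy` only `‖x - y‖ ≤ ρ`, i.e. `‖y‖ ≥ ‖x‖ - ρ ≥ ‖x‖/2`, contributes.
[folklore] -/
theorem norm_heatExtension_le_exp_mul {g : E → F} {ρ : ℝ}
    (hsupp : ∀ z, g z ≠ 0 → ‖z‖ ≤ ρ) (hgi : Integrable g) {t : ℝ} (ht : 0 < t) {x : E}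
    (hx : 2 * ρ ≤ ‖x‖) :
    ‖heatExtension g t x‖ ≤ (4 * π * t) ^ (-(Module.finrank ℝ E : ℝ) / 2) *
      Real.exp (-‖x‖ ^ 2 / (16 * t)) * ∫ z, ‖g z‖ := by
  set c : ℝ := (4 * π * t) ^ (-(Module.finrank ℝ E : ℝ) / 2) * Real.exp (-‖x‖ ^ 2 / (16 * t))
    with hc
  have hc0 : 0 ≤ c := by positivity
  rw [heatExtension_apply]
  -- pointwise bound of the integrand
  have hpt : ∀ y, ‖heatKernel t y • g (x - y)‖ ≤ c * ‖g (x - y)‖ := fun y => by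
    by_cases hzero : g (x - y) = 0
    · simp [hzero]
    · rw [norm_smul, Real.norm_of_nonneg (heatKernel_pos ht y).le]
      refine mul_le_mul_of_nonneg_right ?_ (norm_nonneg _)
      refine heatKernel_le_exp_of_norm_le_two_mul ht ?_
      have h1 : ‖x - y‖ ≤ ρ := hsupp _ hzero
      have h2 : ‖x‖ ≤ ‖x - y‖ + ‖y‖ := norm_le_norm_sub_add x y
      linarith
  have hint : Integrable (fun y => c * ‖g (x - y)‖) :=
    ((hgi.comp_sub_left x).norm).const_mul c
  calc ‖∫ y, heatKernel t y • g (x - y)‖ ≤ ∫ y, c * ‖g (x - y)‖ :=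
        norm_integral_le_of_norm_le hint (Eventually.of_forall hpt)
    _ = c * ∫ y, ‖g (x - y)‖ := integral_const_mul _ _
    _ = c * ∫ z, ‖g z‖ := by
        congr 1
        exact integral_sub_left_eq_self (fun z => ‖g z‖) volume x

/-- **Sup bound of the caloric extension**: `‖heatExtension g t x‖ ≤ C` whenever `‖g‖ ≤ C`
pointwise (`0 < t`; the kernel is nonnegative with total mass one). [folklore] -/
theorem norm_heatExtension_le_of_bound {g : E → F} {C : ℝ} (hC : ∀ z, ‖g z‖ ≤ C) {t : ℝ}
    (ht : 0 < t) (x : E) : ‖heatExtension g t x‖ ≤ C := by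
  have hC0 : 0 ≤ C := (norm_nonneg _).trans (hC 0)
  rw [heatExtension_apply]
  have hK : Integrable (heatKernel (E := E) t) := integrable_heatKernel_holds ht
  have hint : Integrable (fun y : E => heatKernel t y * C) := hK.mul_const C
  calc ‖∫ y, heatKernel t y • g (x - y)‖ ≤ ∫ y, heatKernel t y * C := by
        refine norm_integral_le_of_norm_le hint (Eventually.of_forall fun y => ?_)
        rw [norm_smul, Real.norm_of_nonneg (heatKernel_pos ht y).le]
        exact mul_le_mul_of_nonneg_left (hC _) (heatKernel_pos ht y).le
    _ = C := by rw [integral_mul_const, integral_heatKernel_eq_one_holds ht, one_mul]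

/-- `u^m e^{-u} ≤ m!` for `0 ≤ u` (from `u^m/m! ≤ e^u`). [folklore] -/
theorem pow_mul_exp_neg_le_factorial {u : ℝ} (hu : 0 ≤ u) (m : ℕ) :
    u ^ m * Real.exp (-u) ≤ (m.factorial : ℝ) := by
  have h := Real.pow_div_factorial_le_exp (hx := hu) (n := m)
  have hf : (0 : ℝ) < m.factorial := by positivity
  rw [div_le_iff₀ hf] at h
  rw [Real.exp_neg]
  have he : 0 < Real.exp u := Real.exp_pos u
  calc u ^ m * (Real.exp u)⁻¹ ≤ (Real.exp u * m.factorial) * (Real.exp u)⁻¹ := by gcongr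
    _ = m.factorial := by field_simp

omit [InnerProductSpace ℝ E] [FiniteDimensional ℝ E] [MeasurableSpace E] [BorelSpace E] in
/-- **Even polynomial weights**: `‖x‖^{2m} exp(-‖x‖²/(16t)) ≤ (16 t)^m m!` (`0 < t`). [folklore] -/
theorem pow_two_mul_mul_exp_neg_le {t : ℝ} (ht : 0 < t) (m : ℕ) (x : E) :
    ‖x‖ ^ (2 * m) * Real.exp (-‖x‖ ^ 2 / (16 * t)) ≤ (16 * t) ^ m * m.factorial := by
  set u : ℝ := ‖x‖ ^ 2 / (16 * t) with hu
  have hu0 : 0 ≤ u := by positivity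
  have hxu : ‖x‖ ^ (2 * m) = (16 * t) ^ m * u ^ m := by
    rw [pow_mul, hu, ← mul_pow, mul_div_cancel₀ _ (by positivity)]
  rw [hxu, show -‖x‖ ^ 2 / (16 * t) = -u by rw [hu, neg_div], mul_assoc]
  exact mul_le_mul_of_nonneg_left (pow_mul_exp_neg_le_factorial hu0 m) (by positivity)

/-- **Polynomial decay of the caloric extension of compactly supported data, even weights**:
for continuous compactly supported `g` and `0 < t` there is `C ≥ 0` with
`‖x‖^{2m} ‖heatExtension g t x‖ ≤ C` for all `x` (Gaussian decay off `2ρ`, the sup bound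
inside). [folklore] -/
theorem exists_pow_two_mul_mul_norm_heatExtension_le {g : E → F} (hg : Continuous g)
    (hc : HasCompactSupport g) {t : ℝ} (ht : 0 < t) (m : ℕ) :
    ∃ C : ℝ, 0 ≤ C ∧ ∀ x : E, ‖x‖ ^ (2 * m) * ‖heatExtension g t x‖ ≤ C := by
  -- a support radius and a sup bound
  obtain ⟨ρ₀, hρ₀⟩ := (hc.isCompact.isBounded).subset_closedBall (0 : E)
  set ρ : ℝ := max ρ₀ 0 with hρ
  have hρnn : 0 ≤ ρ := le_max_right _ _
  have hsupp : ∀ z, g z ≠ 0 → ‖z‖ ≤ ρ := fun z hz => by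
    have : z ∈ closedBall (0 : E) ρ₀ := hρ₀ (subset_tsupport _ (Function.mem_support.2 hz))
    rw [mem_closedBall, dist_zero_right] at this
    exact this.trans (le_max_left _ _)
  obtain ⟨B, hB⟩ := hc.exists_bound_of_continuous hg
  have hgi : Integrable g := hg.integrable_of_hasCompactSupport hc
  set A : ℝ := (4 * π * t) ^ (-(Module.finrank ℝ E : ℝ) / 2) * ∫ z, ‖g z‖ with hA
  have hA0 : 0 ≤ A := by positivity
  have hB0 : 0 ≤ B := (norm_nonneg _).trans (hB 0)
  refine ⟨(2 * ρ) ^ (2 * m) * B + A * ((16 * t) ^ m * m.factorial), by positivity, fun x => ?_⟩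
  rcases le_or_gt (2 * ρ) ‖x‖ with hx | hx
  · -- far from the support: Gaussian decay
    have h1 := norm_heatExtension_le_exp_mul hsupp hgi ht hx
    calc ‖x‖ ^ (2 * m) * ‖heatExtension g t x‖
        ≤ ‖x‖ ^ (2 * m) * ((4 * π * t) ^ (-(Module.finrank ℝ E : ℝ) / 2) *
            Real.exp (-‖x‖ ^ 2 / (16 * t)) * ∫ z, ‖g z‖) := by gcongr
      _ = A * (‖x‖ ^ (2 * m) * Real.exp (-‖x‖ ^ 2 / (16 * t))) := by rw [hA]; ring
      _ ≤ A * ((16 * t) ^ m * m.factorial) :=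
          mul_le_mul_of_nonneg_left (pow_two_mul_mul_exp_neg_le ht m x) hA0
      _ ≤ (2 * ρ) ^ (2 * m) * B + A * ((16 * t) ^ m * m.factorial) :=
          le_add_of_nonneg_left (by positivity)
  · -- near the support: the sup bound
    have h1 : ‖heatExtension g t x‖ ≤ B := norm_heatExtension_le_of_bound hB ht x
    calc ‖x‖ ^ (2 * m) * ‖heatExtension g t x‖ ≤ (2 * ρ) ^ (2 * m) * B := by
          gcongr
      _ ≤ (2 * ρ) ^ (2 * m) * B + A * ((16 * t) ^ m * m.factorial) :=
          le_add_of_nonneg_right (by positivity)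

/-- **Polynomial decay of the caloric extension of compactly supported data**: for continuous
compactly supported `g`, `0 < t` and every `k : ℕ` there is `C ≥ 0` with
`‖x‖^k ‖heatExtension g t x‖ ≤ C` for all `x` (`‖x‖^k ≤ 1 + ‖x‖^{2k}`). [folklore] -/
theorem exists_pow_mul_norm_heatExtension_le {g : E → F} (hg : Continuous g)
    (hc : HasCompactSupport g) {t : ℝ} (ht : 0 < t) (k : ℕ) :
    ∃ C : ℝ, 0 ≤ C ∧ ∀ x : E, ‖x‖ ^ k * ‖heatExtension g t x‖ ≤ C := by
  obtain ⟨C₀, hC₀, h₀⟩ := exists_pow_two_mul_mul_norm_heatExtension_le hg hc ht 0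
  obtain ⟨C₁, hC₁, h₁⟩ := exists_pow_two_mul_mul_norm_heatExtension_le hg hc ht k
  refine ⟨C₀ + C₁, by positivity, fun x => ?_⟩
  have hpow : ‖x‖ ^ k ≤ 1 + ‖x‖ ^ (2 * k) := by
    rcases le_or_gt ‖x‖ 1 with h | h
    · calc ‖x‖ ^ k ≤ 1 := pow_le_one₀ (norm_nonneg _) h
        _ ≤ 1 + ‖x‖ ^ (2 * k) := le_add_of_nonneg_right (by positivity)
    · calc ‖x‖ ^ k ≤ ‖x‖ ^ (2 * k) := pow_le_pow_right₀ h.le (by omega)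
        _ ≤ 1 + ‖x‖ ^ (2 * k) := le_add_of_nonneg_left zero_le_one
  have hx0 := h₀ x
  have hx1 := h₁ x
  simp only [mul_zero, pow_zero, one_mul] at hx0
  calc ‖x‖ ^ k * ‖heatExtension g t x‖ ≤ (1 + ‖x‖ ^ (2 * k)) * ‖heatExtension g t x‖ := by
        gcongr
    _ = ‖heatExtension g t x‖ + ‖x‖ ^ (2 * k) * ‖heatExtension g t x‖ := by ring
    _ ≤ C₀ + C₁ := add_le_add hx0 hx1

end Literature.Analysis.UnboundedOperators
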